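import Literature.Geometry.Kaehler.HolomorphicLineBundleSections
import Literature.Geometry.Kaehler.DolbeaultLerayBanach
import Literature.Geometry.Kaehler.AnalyticSetRegular
import Mathlib.Analysis.Normed.Module.FiniteDimension
import Mathlib.Topology.ContinuousMap.Bounded.Normed
import Mathlib.Geometry.Manifold.MFDeriv.Atlas
import HarnessLib

/-!
# Finiteness of `h⁰`: the global holomorphic sections of a line bundle on a compact complex manifold

Layer `Literature/Geometry/Kaehler`, companion of `HolomorphicLineBundle` / `HolomorphicLineBundleSections`
(holomorphic line bundles on a complex manifold `M` presented by a Čech cocycle `g_ij` on a trivialising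
cover `U_i`, Voisin I, §3.3.1 and Thm. 4.49, sections `s = s_i σ_i` with `s_j = g_ij s_i`).

* `HolomorphicLineBundle.sectionSpace L` — the `ℂ`-vector space `Γ(M, L) = H⁰(M, 𝒪(L))` of global
  holomorphic sections, realised as the submodule of `ι → M → ℂ` of families of coordinates `(s_i)`,
  `s_i` holomorphic on `U_i`, `s_j = g_ij s_i` on `U_i ∩ U_j`, NORMALISED by `s_i = 0` off `U_i` (the
  structure `GlobalSection` carries junk values off `U_i`; normalising them makes the coordinates of a
  section unique, so that the vector-space structure is the pointwise one);
  `GlobalSection.normalize` / `ofSectionSpace` pass between the two presentations, and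
  `normalize_eq_zero_iff : σ.normalize = 0 ↔ σ.zeroSet = univ`.
* **`HolomorphicLineBundle.finiteDimensional_sectionSpace`** — for `M` a COMPACT (Hausdorff) complex
  manifold on a finite-dimensional model, `Γ(M, L)` is finite-dimensional: `h⁰(M, L) < ∞`. This is the
  degree-`0` case of the Cartan–Serre finiteness theorem (H. Cartan, J.-P. Serre, C. R. Acad. Sci. Paris
  237 (1953) 128–130; H. Grauert, R. Remmert, *Theorie der Steinschen Räume* (1977), Kap. VI §4), by
  the classical argument: on finitely many chart balls `B_k` (closures inside trivialising sets, the
  half-balls `B'_k` still covering `M`) the sup norms of the coordinates `s_{i_k}` over `B̄'_k` define a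
  norm on `Γ(M, L)`; by the transformation rule and the boundedness of the `g_ij` on compact sets, a
  bound on the `B̄'_k` bounds the coordinates on the `B_k`, so MONTEL's theorem
  (`Literature.Analysis.Complex.SCV.exists_strictMono_tendstoUniformlyOn_of_norm_le`, in the finite
  diagonal form `exists_strictMono_tendstoUniformlyOn_finset`) makes the unit ball compact, and
  F. Riesz's theorem (Mathlib's `FiniteDimensional.of_isCompact_closedBall₀`) concludes.
* `h0 L := finrank ℂ (sectionSpace L)` and the bridge
  `exists_zeroSet_ne_univ_of_h0_pos : 0 < h0 L → ∃ σ : L.GlobalSection, σ.zeroSet ≠ univ` (the form in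
  which dimension counts `h⁰ > 0` are consumed, e.g. by Euler-characteristic arguments).

Everything in this file is proved; the only definitions are `sectionSpace`, `normalize`,
`ofSectionSpace`, `h0` and the auxiliary chart-ball datum `BallDatum` with its evaluation map.

## What is NOT here

The higher cohomology `H^q(M, 𝒪(L))`, `q ≥ 1`, and its finiteness (the twisted Cartan–Serre theorem
needs the Čech–Dolbeault/Leray apparatus of `DolbeaultLerayBanach` with a twisted differential); the
dependence of `h⁰` on the presentation (isomorphic cocycles have isomorphic section spaces — not needed
by the consumers, which quantify over presentations).

## References

* H. Cartan, J.-P. Serre, *Un théorème de finitude concernant les variétés analytiques compactes*,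
  C. R. Acad. Sci. Paris 237 (1953) 128–130. [CartanSerre1953]
* H. Grauert, R. Remmert, *Theorie der Steinschen Räume* (1977), Kap. VI §4. [GrauertRemmert1977]
* C. Voisin, *Hodge Theory and Complex Algebraic Geometry I* (2002), §3.3.1, Thm. 4.49. [VoisinHodgeI2002]
-/

noncomputable section

open scoped Manifold ContDiff Topology BoundedContinuousFunction
open Set Filter Metric Function

namespace Literature.Geometry.Kaehler

namespace HolomorphicLineBundle

variable {ι : Type*} {E : Type*} [NormedAddCommGroup E] [NormedSpace ℂ E]
  {M : Type*} [TopologicalSpace M] [ChartedSpace E M]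

/-! ### The vector space of global holomorphic sections -/

/-- **The space `Γ(M, L) = H⁰(M, 𝒪(L))` of global holomorphic sections** of the cocycle line bundle
`L`, as the submodule of `ι → M → ℂ` of the families of coordinates `(s_i)_i` with `s_i` holomorphic
on `U_i`, `s_j = g_ij s_i` on `U_i ∩ U_j` (Voisin I, proof of Thm. 4.49: the sheaf `𝓛_β` of sections
of the line bundle of the cocycle `β`, here its global sections), normalised by `s_i = 0` off `U_i`
so that a section determines its coordinates. [cite: VoisinHodgeI2002, Thm. 4.49 (proof)] -/
def sectionSpace (L : HolomorphicLineBundle ι E M) : Submodule ℂ (ι → M → ℂ) where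
  carrier := {s | (∀ i, MDifferentiableOn 𝓘(ℂ, E) 𝓘(ℂ, ℂ) (s i) (L.baseSet i)) ∧
      (∀ i j, ∀ x ∈ L.baseSet i ∩ L.baseSet j, s j x = L.coordChange i j x * s i x) ∧
      ∀ i, ∀ x ∉ L.baseSet i, s i x = 0}
  add_mem' := by
    rintro s t ⟨hs₁, hs₂, hs₃⟩ ⟨ht₁, ht₂, ht₃⟩
    refine ⟨fun i ↦ (hs₁ i).add (ht₁ i), fun i j x hx ↦ ?_, fun i x hx ↦ ?_⟩
    · simp only [Pi.add_apply, hs₂ i j x hx, ht₂ i j x hx, mul_add]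
    · simp only [Pi.add_apply, hs₃ i x hx, ht₃ i x hx, add_zero]
  zero_mem' := ⟨fun _ ↦ mdifferentiableOn_const, fun _ _ _ _ ↦ by simp, fun _ _ _ ↦ rfl⟩
  smul_mem' := by
    rintro c s ⟨hs₁, hs₂, hs₃⟩
    refine ⟨fun i ↦ (hs₁ i).const_smul c, fun i j x hx ↦ ?_, fun i x hx ↦ ?_⟩
    · simp only [Pi.smul_apply, smul_eq_mul, hs₂ i j x hx]
      ring
    · simp only [Pi.smul_apply, smul_eq_mul, hs₃ i x hx, mul_zero]

variable {L : HolomorphicLineBundle ι E M}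

/-- Membership in the section space, unfolded. [folklore] -/
theorem mem_sectionSpace_iff {s : ι → M → ℂ} :
    s ∈ L.sectionSpace ↔ (∀ i, MDifferentiableOn 𝓘(ℂ, E) 𝓘(ℂ, ℂ) (s i) (L.baseSet i)) ∧
      (∀ i j, ∀ x ∈ L.baseSet i ∩ L.baseSet j, s j x = L.coordChange i j x * s i x) ∧
      ∀ i, ∀ x ∉ L.baseSet i, s i x = 0 :=
  Iff.rfl

/-- The coordinates of an element of the section space are holomorphic on the trivialising sets.
[folklore] -/
theorem mdifferentiableOn_of_mem_sectionSpace (s : L.sectionSpace) (i : ι) :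
    MDifferentiableOn 𝓘(ℂ, E) 𝓘(ℂ, ℂ) ((s : ι → M → ℂ) i) (L.baseSet i) :=
  s.2.1 i

/-- The transformation rule `s_j = g_ij s_i` for an element of the section space. [folklore] -/
theorem apply_eq_mul_of_mem_sectionSpace (s : L.sectionSpace) (i j : ι) {x : M}
    (hx : x ∈ L.baseSet i ∩ L.baseSet j) :
    (s : ι → M → ℂ) j x = L.coordChange i j x * (s : ι → M → ℂ) i x :=
  s.2.2.1 i j x hx

/-- The normalisation `s_i = 0` off `U_i` for an element of the section space. [folklore] -/
theorem apply_eq_zero_of_notMem (s : L.sectionSpace) (i : ι) {x : M} (hx : x ∉ L.baseSet i) :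
    (s : ι → M → ℂ) i x = 0 :=
  s.2.2.2 i x hx

/-- An element of the section space as a `GlobalSection` (same coordinates). [folklore] -/
def ofSectionSpace (s : L.sectionSpace) : L.GlobalSection where
  coord := s
  mdifferentiableOn_coord := s.2.1
  coord_eq_mul := s.2.2.1

/-- The coordinates of `ofSectionSpace s` are those of `s` (definitional). [folklore] -/
@[simp]
theorem ofSectionSpace_coord (s : L.sectionSpace) (i : ι) (x : M) :
    (ofSectionSpace s).coord i x = (s : ι → M → ℂ) i x :=
  rfl

open Classical in
/-- **Normalisation of a global section**: its coordinates, set to `0` off the trivialising sets; an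
element of the section space. [folklore] -/
def GlobalSection.normalize (σ : L.GlobalSection) : L.sectionSpace :=
  ⟨fun i x ↦ if x ∈ L.baseSet i then σ.coord i x else 0, by
    refine ⟨fun i ↦ (σ.mdifferentiableOn_coord i).congr fun x hx ↦ if_pos hx, fun i j x hx ↦ ?_,
      fun i x hx ↦ if_neg hx⟩
    simp only [if_pos hx.1, if_pos hx.2, σ.coord_eq_mul i j x hx]⟩

/-- The coordinates of the normalised section on the trivialising sets are the original ones.
[folklore] -/
theorem GlobalSection.normalize_apply_of_mem (σ : L.GlobalSection) {i : ι} {x : M}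
    (hx : x ∈ L.baseSet i) : (σ.normalize : ι → M → ℂ) i x = σ.coord i x := by
  classical
  exact if_pos hx

/-- **A section is zero in `Γ(M, L)` iff it vanishes identically.** [folklore] -/
theorem GlobalSection.normalize_eq_zero_iff (σ : L.GlobalSection) :
    σ.normalize = 0 ↔ σ.zeroSet = univ := by
  constructor
  · intro h
    refine eq_univ_of_forall fun x ↦ ?_
    obtain ⟨i, hi⟩ := L.exists_mem_baseSet x
    refine ⟨i, hi, ?_⟩
    rw [← σ.normalize_apply_of_mem hi, h]
    rfl
  · intro h
    refine Subtype.ext (funext fun i ↦ funext fun x ↦ ?_)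
    by_cases hx : x ∈ L.baseSet i
    · rw [σ.normalize_apply_of_mem hx]
      exact (σ.mem_zeroSet_iff hx).1 (h ▸ mem_univ x)
    · exact apply_eq_zero_of_notMem _ i hx

/-- A non-zero element of the section space is a section which is not identically zero.
[folklore] -/
theorem zeroSet_ofSectionSpace_ne_univ {s : L.sectionSpace} (hs : s ≠ 0) :
    (ofSectionSpace s).zeroSet ≠ univ := by
  rw [Ne, ← GlobalSection.normalize_eq_zero_iff]
  intro h
  refine hs (Subtype.ext (funext fun i ↦ funext fun x ↦ ?_))
  by_cases hx : x ∈ L.baseSet i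
  · have := congr_arg (fun u : L.sectionSpace ↦ (u : ι → M → ℂ) i x) h
    simpa only [GlobalSection.normalize_apply_of_mem _ hx, ofSectionSpace_coord] using this
  · exact apply_eq_zero_of_notMem s i hx

variable (L) in
/-- **`h⁰(M, L) = dim_ℂ Γ(M, L)`**, the dimension of the space of global holomorphic sections (Mathlib's
`finrank`, which is `0` on infinite-dimensional spaces; finite-dimensionality for compact `M` is
`finiteDimensional_sectionSpace`). [cite: VoisinHodgeI2002, Thm. 4.49 (proof)] -/
def h0 : ℕ :=
  Module.finrank ℂ L.sectionSpace

/-- **`h⁰ > 0` produces a section which is not identically zero** (a non-zero vector of `Γ(M, L)`).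
[folklore] -/
theorem exists_zeroSet_ne_univ_of_h0_pos (h : 0 < L.h0) : ∃ σ : L.GlobalSection, σ.zeroSet ≠ univ := by
  haveI : Nontrivial L.sectionSpace := Module.nontrivial_of_finrank_pos h
  obtain ⟨s, hs⟩ := exists_ne (0 : L.sectionSpace)
  exact ⟨ofSectionSpace s, zeroSet_ofSectionSpace_ne_univ hs⟩

/-- Conversely a section which is not identically zero spans a line of `Γ(M, L)`, so `h⁰ > 0` as soon
as `Γ(M, L)` is finite-dimensional. [folklore] -/
theorem h0_pos_of_zeroSet_ne_univ [FiniteDimensional ℂ L.sectionSpace] (σ : L.GlobalSection)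
    (hσ : σ.zeroSet ≠ univ) : 0 < L.h0 := by
  rw [Ne, ← GlobalSection.normalize_eq_zero_iff] at hσ
  exact Module.finrank_pos_iff_exists_ne_zero.2 ⟨σ.normalize, hσ⟩

/-! ### Chart balls adapted to the trivialisation -/

section Finite

variable (L)

/-- **Auxiliary datum for the finiteness theorem**: a frame index `frame x` and a radius `R x > 0` at
every point `x` such that the closed chart ball `B̄(x, R x)` (in the extended chart at `x`) lies in the
chart target and is carried by the inverse chart into the trivialising set `U_{frame x}`, together with
a finite set `t` of centres whose half-balls `B(x, R x / 2)` cover `M` (Grauert–Remmert's "Meßatlas"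
in degree `0`). [cite: GrauertRemmert1977, Kap. VI §4] -/
structure BallDatum where
  /-- The finite set of centres. [folklore] -/
  t : Finset M
  /-- A frame index at every point. [folklore] -/
  frame : M → ι
  /-- The radius of the chart ball at every point. [folklore] -/
  R : M → ℝ
  /-- The radii are positive. [folklore] -/
  R_pos : ∀ x, 0 < R x
  /-- The closed chart ball lies in the chart target and over the trivialising set `U_{frame x}`.
  [folklore] -/
  closedBall_subset : ∀ x, closedBall (extChartAt 𝓘(ℂ, E) x x) (R x) ⊆
    (extChartAt 𝓘(ℂ, E) x).target ∩ (extChartAt 𝓘(ℂ, E) x).symm ⁻¹' L.baseSet (frame x)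
  /-- The half-balls centred on `t` cover `M`. [folklore] -/
  cover : ∀ y : M, ∃ x ∈ t, y ∈ (extChartAt 𝓘(ℂ, E) x).source ∧
    extChartAt 𝓘(ℂ, E) x y ∈ ball (extChartAt 𝓘(ℂ, E) x x) (R x / 2)

/-- **On a compact complex manifold a ball datum exists** (small chart balls inside the trivialising
sets, a finite subcover of the half-balls). [cite: GrauertRemmert1977, Kap. VI §4] -/
theorem nonempty_ballDatum [CompactSpace M] : Nonempty (BallDatum L) := by
  classical
  choose frame hframe using L.exists_mem_baseSet
  have hR : ∀ x : M, ∃ R > (0 : ℝ), closedBall (extChartAt 𝓘(ℂ, E) x x) R ⊆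
      (extChartAt 𝓘(ℂ, E) x).target ∩ (extChartAt 𝓘(ℂ, E) x).symm ⁻¹' L.baseSet (frame x) := by
    intro x
    have hO : IsOpen ((extChartAt 𝓘(ℂ, E) x).target ∩
        (extChartAt 𝓘(ℂ, E) x).symm ⁻¹' L.baseSet (frame x)) :=
      isOpen_extChartAt_target_inter_preimage_symm x (L.isOpen_baseSet _)
    have hmem : extChartAt 𝓘(ℂ, E) x x ∈ (extChartAt 𝓘(ℂ, E) x).target ∩
        (extChartAt 𝓘(ℂ, E) x).symm ⁻¹' L.baseSet (frame x) :=
      ⟨mem_extChartAt_target x, by rw [mem_preimage, extChartAt_to_inv]; exact hframe x⟩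
    obtain ⟨ε, hε, hball⟩ := Metric.isOpen_iff.1 hO _ hmem
    exact ⟨ε / 2, half_pos hε, (closedBall_subset_ball (half_lt_self hε)).trans hball⟩
  choose R hRpos hRsub using hR
  set W : M → Set M := fun x ↦ (extChartAt 𝓘(ℂ, E) x).source ∩
    extChartAt 𝓘(ℂ, E) x ⁻¹' ball (extChartAt 𝓘(ℂ, E) x x) (R x / 2) with hW
  have hWo : ∀ x, IsOpen (W x) := fun x ↦
    (continuousOn_extChartAt x).isOpen_inter_preimage (isOpen_extChartAt_source x) isOpen_ball
  have hWx : ∀ x, x ∈ W x := fun x ↦ ⟨mem_extChartAt_source x, mem_ball_self (half_pos (hRpos x))⟩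
  obtain ⟨t, ht⟩ := isCompact_univ.elim_finite_subcover W hWo fun x _ ↦ mem_iUnion.2 ⟨x, hWx x⟩
  refine ⟨⟨t, frame, R, hRpos, hRsub, fun y ↦ ?_⟩⟩
  obtain ⟨x, hx, hy⟩ := mem_iUnion₂.1 (ht (mem_univ y))
  exact ⟨x, hx, hy⟩

namespace BallDatum

variable {L} (D : BallDatum L)

/-- Points of the closed chart ball lie in the chart target. [folklore] -/
theorem mem_target {x : M} {z : E} (hz : z ∈ closedBall (extChartAt 𝓘(ℂ, E) x x) (D.R x)) :
    z ∈ (extChartAt 𝓘(ℂ, E) x).target :=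
  (D.closedBall_subset x hz).1

/-- The inverse chart carries the closed chart ball into `U_{frame x}`. [folklore] -/
theorem symm_mem_baseSet {x : M} {z : E} (hz : z ∈ closedBall (extChartAt 𝓘(ℂ, E) x x) (D.R x)) :
    (extChartAt 𝓘(ℂ, E) x).symm z ∈ L.baseSet (D.frame x) :=
  (D.closedBall_subset x hz).2

/-- The half-ball lies in the ball. [folklore] -/
theorem closedBall_half_subset (x : M) :
    closedBall (extChartAt 𝓘(ℂ, E) x x) (D.R x / 2) ⊆ closedBall (extChartAt 𝓘(ℂ, E) x x) (D.R x) :=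
  closedBall_subset_closedBall (by linarith [D.R_pos x])

/-- A point of the chart source read in the closed chart ball lies in `U_{frame x}`. [folklore] -/
theorem mem_baseSet_frame {x y : M} (hy : y ∈ (extChartAt 𝓘(ℂ, E) x).source)
    (hyb : extChartAt 𝓘(ℂ, E) x y ∈ closedBall (extChartAt 𝓘(ℂ, E) x x) (D.R x)) :
    y ∈ L.baseSet (D.frame x) := by
  have h := D.symm_mem_baseSet hyb
  rwa [(extChartAt 𝓘(ℂ, E) x).left_inv hy] at h

/-- **The compact sets carrying the norm**: the closed half-balls `K_x = B̄(x, R x / 2)`.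
[cite: GrauertRemmert1977, Kap. VI §4] -/
abbrev K (x : M) : Set E :=
  closedBall (extChartAt 𝓘(ℂ, E) x x) (D.R x / 2)

/-- **The chart representative `s_{frame x} ∘ φ_x⁻¹`** of a family of coordinates at the centre `x`.
[cite: GrauertRemmert1977, Kap. VI §4] -/
def rep (s : ι → M → ℂ) (x : M) : E → ℂ :=
  fun z ↦ s (D.frame x) ((extChartAt 𝓘(ℂ, E) x).symm z)

/-- The representative, unfolded. [folklore] -/
theorem rep_apply (s : ι → M → ℂ) (x : M) (z : E) :
    D.rep s x z = s (D.frame x) ((extChartAt 𝓘(ℂ, E) x).symm z) :=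
  rfl

/-- The representative at the image of a point of the chart source. [folklore] -/
theorem rep_extChartAt (s : ι → M → ℂ) {x y : M} (hy : y ∈ (extChartAt 𝓘(ℂ, E) x).source) :
    D.rep s x (extChartAt 𝓘(ℂ, E) x y) = s (D.frame x) y := by
  rw [rep_apply, (extChartAt 𝓘(ℂ, E) x).left_inv hy]

/-- The representative of a section is continuous on the closed chart ball. [folklore] -/
theorem continuousOn_rep (s : L.sectionSpace) (x : M) :
    ContinuousOn (D.rep s x) (closedBall (extChartAt 𝓘(ℂ, E) x x) (D.R x)) :=
  (mdifferentiableOn_of_mem_sectionSpace s _).continuousOn.comp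
    ((continuousOn_extChartAt_symm x).mono fun _ hz ↦ D.mem_target hz) fun _ hz ↦ D.symm_mem_baseSet hz

/-- The representative of a section is holomorphic on the open chart ball. [folklore] -/
theorem differentiableOn_rep [IsManifold 𝓘(ℂ, E) ω M] (s : L.sectionSpace) (x : M) :
    DifferentiableOn ℂ (D.rep s x) (ball (extChartAt 𝓘(ℂ, E) x x) (D.R x)) :=
  (MDifferentiableOn.differentiableOn_extChartAt_symm
    (mdifferentiableOn_of_mem_sectionSpace s (D.frame x)) x).mono
      (ball_subset_closedBall.trans (D.closedBall_subset x))

variable [ProperSpace E]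

/-- **The evaluation of a section on the compact half-ball `K_x`**, a bounded continuous function.
[cite: GrauertRemmert1977, Kap. VI §4] -/
def evalK (s : L.sectionSpace) (x : M) : D.K x →ᵇ ℂ :=
  BoundedContinuousFunction.mkOfCompact
    ⟨(D.K x).restrict (D.rep s x),
      continuousOn_iff_continuous_restrict.1 ((D.continuousOn_rep s x).mono (D.closedBall_half_subset x))⟩

/-- Evaluation, unfolded. [folklore] -/
@[simp]
theorem evalK_apply (s : L.sectionSpace) (x : M) (z : D.K x) : D.evalK s x z = D.rep s x z :=
  rfl

/-- **The evaluation map `Γ(M, L) → Π_{x ∈ t} C_b(K_x, ℂ)`** (sup norms of the coordinates on the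
finitely many closed half-balls), a linear map. [cite: GrauertRemmert1977, Kap. VI §4] -/
def eval : L.sectionSpace →ₗ[ℂ] ((x : D.t) → (D.K (x : M) →ᵇ ℂ)) where
  toFun s x := D.evalK s x
  map_add' s s' := by
    funext x
    ext z
    rfl
  map_smul' c s := by
    funext x
    ext z
    rfl

/-- Evaluation map, unfolded. [folklore] -/
@[simp]
theorem eval_apply (s : L.sectionSpace) (x : D.t) : D.eval s x = D.evalK s x :=
  rfl

/-- The coordinates on the half-balls are bounded by the norm of the evaluation. [folklore] -/
theorem norm_rep_le_norm_eval (s : L.sectionSpace) (x : D.t) {z : E} (hz : z ∈ D.K x) :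
    ‖D.rep s x z‖ ≤ ‖D.eval s‖ :=
  ((D.evalK s x).norm_coe_le_norm ⟨z, hz⟩).trans (norm_le_pi_norm (D.eval s) x)

/-- **The evaluation map is injective**: a section vanishing on the half-balls of the centres vanishes
(the half-balls cover `M`, and `s_i = g_{frame x, i} s_{frame x}`). [cite: GrauertRemmert1977, Kap. VI §4] -/
theorem eval_injective : Injective D.eval := by
  refine (injective_iff_map_eq_zero _).2 fun s hs ↦ ?_
  have h1 : ∀ x ∈ D.t, ∀ y ∈ (extChartAt 𝓘(ℂ, E) x).source,
      extChartAt 𝓘(ℂ, E) x y ∈ ball (extChartAt 𝓘(ℂ, E) x x) (D.R x / 2) →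
        (s : ι → M → ℂ) (D.frame x) y = 0 := by
    intro x hx y hy hyb
    have h := congr_fun (congr_arg DFunLike.coe (congr_fun hs ⟨x, hx⟩)) ⟨_, ball_subset_closedBall hyb⟩
    rwa [eval_apply, evalK_apply, D.rep_extChartAt _ hy] at h
  refine Subtype.ext (funext fun i ↦ funext fun y ↦ ?_)
  by_cases hy : y ∈ L.baseSet i
  · obtain ⟨x, hx, hys, hyb⟩ := D.cover y
    have hyf : y ∈ L.baseSet (D.frame x) :=
      D.mem_baseSet_frame hys (D.closedBall_half_subset x (ball_subset_closedBall hyb))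
    rw [apply_eq_mul_of_mem_sectionSpace s (D.frame x) i ⟨hyf, hy⟩, h1 x hx y hys hyb, mul_zero]
    rfl
  · exact apply_eq_zero_of_notMem s i hy

/-- **A bound on the half-balls bounds the coordinates on the full balls**: there is `G ≥ 0` with
`‖s_{frame x}(φ_x⁻¹ z)‖ ≤ G ‖eval s‖` for all sections `s`, centres `x ∈ t` and `z ∈ B(x, R x)` — every
point lies in a half-ball of some centre `x'`, where `s_{frame x} = g_{frame x', frame x} s_{frame x'}`,
and the transition functions are bounded on the compact sets `φ_x⁻¹ B̄(x, R x) ∩ φ_{x'}⁻¹ B̄(x', R x'/2)`.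
[cite: GrauertRemmert1977, Kap. VI §4] -/
theorem exists_norm_rep_le [T2Space M] : ∃ G : ℝ, 0 ≤ G ∧ ∀ (s : L.sectionSpace) (x : D.t) (z : E),
    z ∈ ball (extChartAt 𝓘(ℂ, E) (x : M) x) (D.R x) → ‖D.rep s x z‖ ≤ G * ‖D.eval s‖ := by
  -- bounds for the transition functions on compact sets
  have hB : ∀ x x' : M, ∃ B : ℝ, ∀ y ∈ (extChartAt 𝓘(ℂ, E) x).symm ''
      closedBall (extChartAt 𝓘(ℂ, E) x x) (D.R x) ∩ (extChartAt 𝓘(ℂ, E) x').symm ''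
        closedBall (extChartAt 𝓘(ℂ, E) x' x') (D.R x' / 2),
      ‖L.coordChange (D.frame x') (D.frame x) y‖ ≤ B := by
    intro x x'
    have h₁ : IsCompact ((extChartAt 𝓘(ℂ, E) x).symm '' closedBall (extChartAt 𝓘(ℂ, E) x x) (D.R x)) :=
      (isCompact_closedBall _ _).image_of_continuousOn
        ((continuousOn_extChartAt_symm x).mono fun _ hz ↦ D.mem_target hz)
    have h₂ : IsCompact ((extChartAt 𝓘(ℂ, E) x').symm ''
        closedBall (extChartAt 𝓘(ℂ, E) x' x') (D.R x' / 2)) :=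
      (isCompact_closedBall _ _).image_of_continuousOn
        ((continuousOn_extChartAt_symm x').mono fun _ hz ↦ D.mem_target (D.closedBall_half_subset x' hz))
    obtain ⟨B, hB⟩ := (h₁.inter_right h₂.isClosed).exists_bound_of_continuousOn
      (f := L.coordChange (D.frame x') (D.frame x))
      ((L.mdifferentiableOn_coordChange _ _).continuousOn.mono (by
        rintro y ⟨⟨z, hz, rfl⟩, ⟨z', hz', hzz'⟩⟩
        exact ⟨by rw [← hzz']; exact D.symm_mem_baseSet (D.closedBall_half_subset x' hz'),
          D.symm_mem_baseSet hz⟩))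
    exact ⟨B, hB⟩
  choose B hB using hB
  obtain ⟨G₀, hG₀⟩ := (Set.finite_range fun q : D.t × D.t ↦ B q.1 q.2).bddAbove
  refine ⟨max G₀ 0, le_max_right _ _, fun s x z hz ↦ ?_⟩
  set y := (extChartAt 𝓘(ℂ, E) (x : M)).symm z with hy
  obtain ⟨x', hx', hys, hyb⟩ := D.cover y
  have hyf' : y ∈ L.baseSet (D.frame x') :=
    D.mem_baseSet_frame hys (D.closedBall_half_subset x' (ball_subset_closedBall hyb))
  have hyf : y ∈ L.baseSet (D.frame x) := D.symm_mem_baseSet (ball_subset_closedBall hz)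
  have h1 : ‖(s : ι → M → ℂ) (D.frame x') y‖ ≤ ‖D.eval s‖ := by
    have h := D.norm_rep_le_norm_eval s ⟨x', hx'⟩ (ball_subset_closedBall hyb)
    rwa [D.rep_extChartAt _ hys] at h
  have h2 : ‖L.coordChange (D.frame x') (D.frame x) y‖ ≤ max G₀ 0 := by
    refine (hB x x' y ⟨⟨z, ball_subset_closedBall hz, rfl⟩, ⟨extChartAt 𝓘(ℂ, E) x' y,
      ball_subset_closedBall hyb, (extChartAt 𝓘(ℂ, E) x').left_inv hys⟩⟩).trans ?_
    exact (hG₀ ⟨(x, ⟨x', hx'⟩), rfl⟩).trans (le_max_left _ _)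
  calc ‖D.rep s x z‖ = ‖L.coordChange (D.frame x') (D.frame x) y * (s : ι → M → ℂ) (D.frame x') y‖ := by
        rw [rep_apply, ← hy, apply_eq_mul_of_mem_sectionSpace s (D.frame x') (D.frame x) ⟨hyf', hyf⟩]
    _ ≤ max G₀ 0 * ‖D.eval s‖ := by
        rw [norm_mul]
        exact mul_le_mul h2 h1 (norm_nonneg _) (le_max_right _ _)

/-- **The unit ball of `eval (Γ(M, L))` is sequentially compact** (Montel's theorem on the finitely
many chart balls, one common subsequence; the limits of the coordinates glue to a section by the
transformation rule, which passes to the limit). [cite: GrauertRemmert1977, Kap. VI §4] -/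
theorem isSeqCompact_closedBall [T2Space M] [IsManifold 𝓘(ℂ, E) ω M] [FiniteDimensional ℂ E] :
    IsSeqCompact (closedBall (0 : LinearMap.range D.eval) 1) := by
  intro u hu
  obtain ⟨G, hG0, hG⟩ := D.exists_norm_rep_le
  have hu' : ∀ n, ∃ s : L.sectionSpace, D.eval s = (u n : (x : D.t) → (D.K (x : M) →ᵇ ℂ)) :=
    fun n ↦ (u n).2
  choose s hs using hu'
  have hsn : ∀ n, ‖D.eval (s n)‖ ≤ 1 := fun n ↦ by
    rw [hs]
    exact mem_closedBall_zero_iff.1 (hu n)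
  -- Montel on the finitely many chart balls
  have hbd : ∀ n (x : D.t), ∀ z ∈ ball (extChartAt 𝓘(ℂ, E) (x : M) x) (D.R x),
      ‖D.rep (s n) x z‖ ≤ G := fun n x z hz ↦
    (hG (s n) x z hz).trans (by nlinarith [hsn n, norm_nonneg (D.eval (s n))])
  obtain ⟨g, φ, hφ, hg⟩ := exists_strictMono_tendstoUniformlyOn_finset (F := ℂ) (Finset.univ : Finset D.t)
    (Uo := fun x : D.t ↦ ball (extChartAt 𝓘(ℂ, E) (x : M) x) (D.R x)) (K := fun x : D.t ↦ D.K x)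
    (fun _ ↦ isOpen_ball) (fun _ ↦ isCompact_closedBall _ _)
    (fun x ↦ closedBall_subset_ball (by linarith [D.R_pos x]))
    (f := fun n x ↦ D.rep (s n) x) (fun n x ↦ D.differentiableOn_rep (s n) x) hbd
  -- pointwise convergence of all coordinates
  have htend : ∀ (i : ι) (y : M), y ∈ L.baseSet i → ∀ x : D.t, y ∈ (extChartAt 𝓘(ℂ, E) (x : M)).source →
      extChartAt 𝓘(ℂ, E) (x : M) y ∈ D.K x →
        Tendsto (fun n ↦ (s (φ n) : ι → M → ℂ) i y) atTop
          (𝓝 (L.coordChange (D.frame x) i y * g x (extChartAt 𝓘(ℂ, E) (x : M) y))) := by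
    intro i y hyi x hys hyK
    have hyf : y ∈ L.baseSet (D.frame x) := D.mem_baseSet_frame hys (D.closedBall_half_subset x hyK)
    have heq : ∀ n, (s (φ n) : ι → M → ℂ) i y =
        L.coordChange (D.frame x) i y * D.rep (s (φ n)) x (extChartAt 𝓘(ℂ, E) (x : M) y) := fun n ↦ by
      rw [D.rep_extChartAt _ hys, apply_eq_mul_of_mem_sectionSpace (s (φ n)) (D.frame x) i ⟨hyf, hyi⟩]
    simp only [heq]
    exact ((hg x (Finset.mem_univ x)).2.2.tendsto_at hyK).const_mul _
  -- the cover witnesses and the limit coordinates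
  choose cw hcw hcws hcwb using D.cover
  classical
  set ℓ : ι → M → ℂ := fun i y ↦ if y ∈ L.baseSet i then
    L.coordChange (D.frame (cw y)) i y * g ⟨cw y, hcw y⟩ (extChartAt 𝓘(ℂ, E) (cw y) y) else 0 with hℓdef
  have hℓ : ∀ (i : ι) (y : M), y ∈ L.baseSet i →
      Tendsto (fun n ↦ (s (φ n) : ι → M → ℂ) i y) atTop (𝓝 (ℓ i y)) := by
    intro i y hyi
    simp only [hℓdef, if_pos hyi]
    exact htend i y hyi ⟨cw y, hcw y⟩ (hcws y) (ball_subset_closedBall (hcwb y))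
  -- the limit is a section
  have hℓmem : ℓ ∈ L.sectionSpace := by
    refine ⟨fun i y₀ hy₀ ↦ ?_, fun i j y hy ↦ ?_, fun i y hy ↦ by simp only [hℓdef, if_neg hy]⟩
    · -- holomorphy near `y₀`, through the centre `x₀ = cw y₀`
      set x₀ : D.t := ⟨cw y₀, hcw y₀⟩ with hx₀
      set O : Set M := L.baseSet i ∩ ((extChartAt 𝓘(ℂ, E) (x₀ : M)).source ∩
        extChartAt 𝓘(ℂ, E) (x₀ : M) ⁻¹' ball (extChartAt 𝓘(ℂ, E) (x₀ : M) x₀) (D.R x₀ / 2)) with hO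
      have hOo : IsOpen O := (L.isOpen_baseSet i).inter
        ((continuousOn_extChartAt _).isOpen_inter_preimage (isOpen_extChartAt_source _) isOpen_ball)
      have hy₀O : y₀ ∈ O := ⟨hy₀, hcws y₀, hcwb y₀⟩
      set F : M → ℂ := fun y ↦ L.coordChange (D.frame x₀) i y * g x₀ (extChartAt 𝓘(ℂ, E) (x₀ : M) y)
        with hF
      have hFeq : ∀ y ∈ O, ℓ i y = F y := fun y hy ↦
        tendsto_nhds_unique (hℓ i y hy.1) (htend i y hy.1 x₀ hy.2.1 (ball_subset_closedBall hy.2.2))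
      have hOf : O ⊆ L.baseSet (D.frame x₀) := fun y hy ↦
        D.mem_baseSet_frame hy.2.1 (D.closedBall_half_subset _ (ball_subset_closedBall hy.2.2))
      have hg' : MDifferentiableOn 𝓘(ℂ, E) 𝓘(ℂ, ℂ) (g x₀ ∘ extChartAt 𝓘(ℂ, E) (x₀ : M))
          ((extChartAt 𝓘(ℂ, E) (x₀ : M)).source ∩
            extChartAt 𝓘(ℂ, E) (x₀ : M) ⁻¹' ball (extChartAt 𝓘(ℂ, E) (x₀ : M) x₀) (D.R x₀ / 2)) := by
        refine (mdifferentiableOn_iff_differentiableOn.2 (hg x₀ (Finset.mem_univ x₀)).1).comp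
          ((mdifferentiableOn_extChartAt (I := 𝓘(ℂ, E)) (x := (x₀ : M))).mono ?_) ?_
        · intro y hy
          rw [← extChartAt_source 𝓘(ℂ, E)]
          exact hy.1
        · intro y hy
          exact ball_subset_ball (by linarith [D.R_pos x₀]) hy.2
      have hFd : MDifferentiableOn 𝓘(ℂ, E) 𝓘(ℂ, ℂ) F O :=
        ((L.mdifferentiableOn_coordChange (D.frame x₀) i).mono fun y hy ↦ ⟨hOf hy, hy.1⟩).mul
          (hg'.mono fun y hy ↦ hy.2)
      have hFat : MDifferentiableAt 𝓘(ℂ, E) 𝓘(ℂ, ℂ) F y₀ := (hFd y₀ hy₀O).mdifferentiableAt (hOo.mem_nhds hy₀O)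
      have hev : ℓ i =ᶠ[𝓝 y₀] F := by
        filter_upwards [hOo.mem_nhds hy₀O] with y hy
        exact hFeq y hy
      exact (hFat.congr_of_eventuallyEq hev).mdifferentiableWithinAt
    · -- the transformation rule passes to the limit
      have hyf : y ∈ L.baseSet (D.frame (cw y)) :=
        D.mem_baseSet_frame (hcws y) (D.closedBall_half_subset _ (ball_subset_closedBall (hcwb y)))
      simp only [hℓdef, if_pos hy.1, if_pos hy.2]
      rw [← L.coordChange_comp (D.frame (cw y)) i j y ⟨⟨hyf, hy.1⟩, hy.2⟩]
      ring
  set sℓ : L.sectionSpace := ⟨ℓ, hℓmem⟩ with hsℓ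
  -- on the half-balls the limit coordinates are Montel's limits
  have hrepℓ : ∀ (x : D.t) (z : E), z ∈ D.K x → D.rep sℓ x z = g x z := by
    intro x z hz
    have hzt : z ∈ (extChartAt 𝓘(ℂ, E) (x : M)).target := D.mem_target (D.closedBall_half_subset x hz)
    have hys : (extChartAt 𝓘(ℂ, E) (x : M)).symm z ∈ (extChartAt 𝓘(ℂ, E) (x : M)).source :=
      (extChartAt 𝓘(ℂ, E) (x : M)).map_target hzt
    have hyf : (extChartAt 𝓘(ℂ, E) (x : M)).symm z ∈ L.baseSet (D.frame x) :=
      D.symm_mem_baseSet (D.closedBall_half_subset x hz)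
    have h1 := hℓ (D.frame x) _ hyf
    have h2 := htend (D.frame x) _ hyf x hys (by rwa [(extChartAt 𝓘(ℂ, E) (x : M)).right_inv hzt])
    rw [(extChartAt 𝓘(ℂ, E) (x : M)).right_inv hzt, L.coordChange_self _ hyf, one_mul] at h2
    exact tendsto_nhds_unique h1 h2
  -- convergence in norm
  have hconv : Tendsto (fun n ↦ D.eval (s (φ n))) atTop (𝓝 (D.eval sℓ)) := by
    refine tendsto_pi_nhds.2 fun x ↦ ?_
    rw [BoundedContinuousFunction.tendsto_iff_tendstoUniformly]
    have h := (hg x (Finset.mem_univ x)).2.2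
    rw [tendstoUniformlyOn_iff_tendstoUniformly_comp_coe] at h
    have hfun : (⇑(D.eval sℓ x) : D.K x → ℂ) = g x ∘ Subtype.val := funext fun z ↦ hrepℓ x z z.2
    rw [hfun]
    exact h
  -- the limit point, in the unit ball of the range
  have hmem : D.eval sℓ ∈ closedBall (0 : (x : D.t) → (D.K (x : M) →ᵇ ℂ)) 1 :=
    isClosed_closedBall.mem_of_tendsto hconv
      (Eventually.of_forall fun n ↦ mem_closedBall_zero_iff.2 (hsn (φ n)))
  refine ⟨⟨D.eval sℓ, sℓ, rfl⟩, mem_closedBall_zero_iff.2 (mem_closedBall_zero_iff.1 hmem), φ, hφ, ?_⟩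
  rw [Topology.IsEmbedding.subtypeVal.tendsto_nhds_iff]
  convert hconv using 1
  funext n
  simp only [Function.comp_apply, hs]

end BallDatum

/-- **Finiteness of `h⁰` (Cartan–Serre in degree `0`)**: on a compact Hausdorff complex manifold
modelled on a finite-dimensional space, the space `Γ(M, L)` of global holomorphic sections of a
holomorphic line bundle presented by a cocycle is finite-dimensional. H. Cartan, J.-P. Serre (1953);
Grauert–Remmert (1977), Kap. VI §4 (for every coherent analytic sheaf; here `𝒪(L)` and `q = 0`, by
Montel's theorem and F. Riesz's theorem). [cite: CartanSerre1953] -/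
theorem finiteDimensional_sectionSpace [FiniteDimensional ℂ E] [T2Space M] [CompactSpace M]
    [IsManifold 𝓘(ℂ, E) ω M] : FiniteDimensional ℂ L.sectionSpace := by
  haveI : ProperSpace E := FiniteDimensional.proper_rclike ℂ E
  obtain ⟨D⟩ := nonempty_ballDatum L
  haveI : FiniteDimensional ℂ (LinearMap.range D.eval) :=
    FiniteDimensional.of_isCompact_closedBall₀ ℂ one_pos D.isSeqCompact_closedBall.isCompact
  exact Module.Finite.equiv (LinearEquiv.ofInjective D.eval D.eval_injective).symm

end Finite

end HolomorphicLineBundle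

end Literature.Geometry.Kaehler
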